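import Summits.CriticalPhenomena.SAWScalingLimit.Theorems.SAWEdgeOfPositiveTypeConvexMetricUpgradeDomain
import Summits.CriticalPhenomena.SAWScalingLimit.Theorems.SAWEdgeOfPositiveTypeConvexMetricUpgradeStaircase
import Mathlib.Analysis.Complex.ExponentialBounds

/-!
# Route `SAWEdgeOfPositiveType`: the engine `ConvexMetricUpgrade` (stmt-CriticalPhenomena-13964)

`ConvexMetricTriangle → AveragedTubeMass → TubeLowerBound`: the square-root-of-free-energy metric on convex
lattice tubes turns the mesoscopically averaged critical tube mass into a pointwise polynomial floor.

Proof (a reverse Simon–Lieb inequality up to polynomial factors).  Fix `u, v`, `ℓ ≥ max(1, |u − v|)`, the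
convex tube `K = cthickening (ℓ/10 + 2) [u, v]` and its lattice trace `T`; write `Z = Z^T_{x_c}`, `F = −log Z`.
* PIGEONHOLE (`exists_endpoint`): the averaged mass `≥ c ℓ^{-C}` of `AveragedTubeMass` is carried by the
  `≤ 9 ℓ^{2α}` lattice endpoints of the ball `B(v, ℓ^α)`, so some `w` there has `Z(u,w) ≥ (c/9) ℓ^{-(C+2)}`.
* NESTING: for `ℓ ≥ L₀ = 11^{1/(1−α)}` one has `11 ℓ^α ≤ ℓ`, so the trace of the tube of `(w, v, ℓ^α)` lies in
  `T` and `Z(w,v) ≥ Z^{T'}(w,v)` (domain monotonicity), bounded below by INDUCTION on `⌊ℓ⌋₊`.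
* METRIC STEP: `ConvexMetricTriangle` in `T` gives `√F(u,v) ≤ √F(u,w) + √F(w,v) ≤ √P + √Q` with
  `P = (C+2) log ℓ + log(9/c)`, `Q = α D log ℓ + E`; by `2√(PQ) ≤ P/ε + εQ` (`ε = (1−α)/2`) the recursion
  CLOSES with fixed constants: `F(u,v) ≤ (1 + 1/ε) P + (1 + ε) Q ≤ D log ℓ + E` for
  `D = (1 + 1/ε)(C + 2 + log(9/c))/ε + E`, `E = 2 L₀ log(1/x_c) + log(9/c)`.
* BASE / POSITIVITY: the digital line (`exists_digital_saw`) is a confined walk `u → v` of `≤ 2ℓ` steps, so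
  `Z(u,v) ≥ x_c^{2ℓ} > 0` at every scale (needed also because `log 0 = 0` makes the triangle inequality blind
  to positivity), which settles `ℓ < L₀`.
Hence `Z^T(u,v) ≥ e^{-E} ℓ^{-D}`, and `Z^T(u,v)` is a partial sum of `TubeLowerBound` (`N = |T|`).

## References

* C. Berg, J. P. R. Christensen, P. Ressel, *Harmonic Analysis on Semigroups* (1984), Ch. 3 §3
  [BergChristensenRessel1984].
* N. Madras, G. Slade, *The Self-Avoiding Walk* (1993), §1.2 and p. 202 [MadrasSlade1993].
-/

noncomputable section

namespace Summit.CriticalPhenomena.SAWScalingLimit.Theorems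

namespace ConvexMetricUpgrade

open scoped BigOperators Classical
open Literature.Probability.LatticeModels
open Literature.Probability.RandomPlanarGeometry Literature.Probability.RandomPlanarGeometry.SAW
open Summit.CriticalPhenomena.SAWScalingLimit.Theses.SAWEdgeOfPositiveType
  (ConvexMetricTriangle AveragedTubeMass TubeLowerBound)
open Summit.CriticalPhenomena.SAWScalingLimit.Theorems.IDRefutation (Zfun)

/-! ### Pigeonhole: a good endpoint near `v` -/

/-- **Pigeonhole on the averaged tube mass.**  If the `x_c`-mass of tube-confined walks from `u` ending within
`ℓ^α` of `v` is `≥ c ℓ^{-C}` (`0 ≤ α ≤ 1`), then some lattice point `w` with `|w − v| ≤ ℓ^α` carries kernel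
`Z^T(u,w) ≥ (c/9) ℓ^{-(C+2)}` in the trace `T` of the tube. [cite: MadrasSlade1993, §1.2] -/
theorem exists_endpoint {α C c : ℝ} (hα0 : 0 ≤ α) (hα1 : α ≤ 1) (hc : 0 < c) {u v : Site 2} {ℓ : ℝ}
    (hℓ : 1 ≤ ℓ) {N : ℕ}
    (hN : c * ℓ ^ (-C) ≤ ∑ n ∈ Finset.range (N + 1), ∑ _ω ∈ (Zd.saws 2 n).filter (fun ω =>
        (∀ i ≤ n, Metric.infDist (Site.toComplex (u + ω i))
          (segment ℝ (Site.toComplex u) (Site.toComplex v)) ≤ ℓ / 10 + 2) ∧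
          dist (Site.toComplex (u + ω n)) (Site.toComplex v) ≤ ℓ ^ α), criticalFugacity ^ n)
    {T : Finset (Site 2)} (hT : ∀ z : Site 2, z ∈ T ↔
      Site.toComplex z ∈ Metric.cthickening (ℓ / 10 + 2) (segment ℝ (Site.toComplex u) (Site.toComplex v))) :
    ∃ w : Site 2, dist (Site.toComplex w) (Site.toComplex v) ≤ ℓ ^ α ∧
      c / 9 * ℓ ^ (-(C + 2)) ≤ Zfun T criticalFugacity u w := by
  have hℓ0 : 0 ≤ ℓ := by linarith
  have hℓpos : 0 < ℓ := by linarith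
  set R : ℝ := ℓ ^ α with hR
  have hR1 : 1 ≤ R := Real.one_le_rpow hℓ hα0
  have hRℓ : R ≤ ℓ := by
    calc R = ℓ ^ α := hR
      _ ≤ ℓ ^ (1 : ℝ) := Real.rpow_le_rpow_of_exponent_le hℓ hα1
      _ = ℓ := Real.rpow_one ℓ
  obtain ⟨B, hBmem, hBcard⟩ := exists_ball_finset v hR1
  have hvB : v ∈ B := (hBmem v).2 (by rw [dist_self]; linarith)
  have hBne : B.Nonempty := ⟨v, hvB⟩
  have hBpos : (0 : ℝ) < B.card := by exact_mod_cast Finset.card_pos.2 hBne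
  -- decompose the averaged sum over the endpoint
  have hdec : (∑ n ∈ Finset.range (N + 1), ∑ _ω ∈ (Zd.saws 2 n).filter (fun ω =>
        (∀ i ≤ n, Metric.infDist (Site.toComplex (u + ω i))
          (segment ℝ (Site.toComplex u) (Site.toComplex v)) ≤ ℓ / 10 + 2) ∧
          dist (Site.toComplex (u + ω n)) (Site.toComplex v) ≤ ℓ ^ α), criticalFugacity ^ n) ≤
      ∑ w ∈ B, Zfun T criticalFugacity u w := by
    calc (∑ n ∈ Finset.range (N + 1), ∑ _ω ∈ (Zd.saws 2 n).filter (fun ω =>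
          (∀ i ≤ n, Metric.infDist (Site.toComplex (u + ω i))
            (segment ℝ (Site.toComplex u) (Site.toComplex v)) ≤ ℓ / 10 + 2) ∧
            dist (Site.toComplex (u + ω n)) (Site.toComplex v) ≤ ℓ ^ α), criticalFugacity ^ n)
        = ∑ n ∈ Finset.range (N + 1), ∑ w ∈ B, ∑ _ω ∈ ((Zd.saws 2 n).filter (fun ω =>
            (∀ i ≤ n, Metric.infDist (Site.toComplex (u + ω i))
              (segment ℝ (Site.toComplex u) (Site.toComplex v)) ≤ ℓ / 10 + 2) ∧
              dist (Site.toComplex (u + ω n)) (Site.toComplex v) ≤ ℓ ^ α)).filter (fun ω => u + ω n = w),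
            criticalFugacity ^ n := by
          refine Finset.sum_congr rfl fun n _ => ?_
          symm
          refine Finset.sum_fiberwise_of_maps_to (fun ω hω => ?_) _
          rw [Finset.mem_filter] at hω
          exact (hBmem _).2 hω.2.2
      _ ≤ ∑ n ∈ Finset.range (N + 1), ∑ w ∈ B, ∑ _ω ∈ (Zd.sawFun 2 n (w - u)).filter
            (fun ω => ∀ i ≤ n, u + ω i ∈ T), criticalFugacity ^ n := by
          refine Finset.sum_le_sum fun n _ => Finset.sum_le_sum fun w _ => ?_
          refine Finset.sum_le_sum_of_subset_of_nonneg (fun ω hω => ?_)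
            fun _ _ _ => pow_nonneg criticalFugacity_pos.le n
          rw [Finset.mem_filter, Finset.mem_filter] at hω
          obtain ⟨⟨hω, hconf, -⟩, hend⟩ := hω
          rw [Finset.mem_filter]
          refine ⟨Zd.mem_sawFun_iff_mem_saws.2 ⟨hω, ?_⟩, fun i hi => (trace_infDist hℓ0 hT _).2 (hconf i hi)⟩
          rw [← hend, add_sub_cancel_left]
      _ = ∑ w ∈ B, ∑ n ∈ Finset.range (N + 1), ∑ _ω ∈ (Zd.sawFun 2 n (w - u)).filter
            (fun ω => ∀ i ≤ n, u + ω i ∈ T), criticalFugacity ^ n := Finset.sum_comm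
      _ ≤ ∑ w ∈ B, Zfun T criticalFugacity u w := Finset.sum_le_sum fun w _ => partial_le_zfun T u w N
  -- pigeonhole
  have htot : ∑ _w ∈ B, c * ℓ ^ (-C) / B.card ≤ ∑ w ∈ B, Zfun T criticalFugacity u w := by
    rw [Finset.sum_const, nsmul_eq_mul, mul_div_cancel₀ _ hBpos.ne']
    exact hN.trans hdec
  obtain ⟨w, hwB, hw⟩ := Finset.exists_le_of_sum_le hBne htot
  refine ⟨w, (hBmem w).1 hwB, le_trans ?_ hw⟩
  -- `(c/9) ℓ^{-(C+2)} ≤ c ℓ^{-C} / |B|` since `|B| ≤ 9 ℓ^{2α} ≤ 9 ℓ²`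
  have hcard : (B.card : ℝ) ≤ 9 * ℓ ^ 2 := hBcard.trans (by nlinarith [hR1, hRℓ])
  have hpow : ℓ ^ (-(C + 2)) = ℓ ^ (-C) / ℓ ^ 2 := by
    rw [show -(C + 2) = -C + -(2 : ℝ) by ring, Real.rpow_add hℓpos, Real.rpow_neg hℓ0 (2 : ℝ),
      Real.rpow_two, div_eq_mul_inv]
  rw [hpow]
  have hnum : 0 ≤ c * ℓ ^ (-C) := mul_nonneg hc.le (Real.rpow_nonneg hℓ0 _)
  calc c / 9 * (ℓ ^ (-C) / ℓ ^ 2) = c * ℓ ^ (-C) / (9 * ℓ ^ 2) := by ring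
    _ ≤ c * ℓ ^ (-C) / B.card := div_le_div_of_nonneg_left hnum hBpos hcard

/-! ### Real-variable inequalities of the tower -/

/-- `(√P + √Q)² ≤ (1 + 1/ε) P + (1 + ε) Q` for `P, Q ≥ 0`, `ε > 0` (from `2√(PQ) ≤ P/ε + εQ`). [folklore] -/
theorem sq_sqrt_add_sqrt_le {P Q ε : ℝ} (hP : 0 ≤ P) (hQ : 0 ≤ Q) (hε : 0 < ε) :
    (Real.sqrt P + Real.sqrt Q) ^ 2 ≤ (1 + 1 / ε) * P + (1 + ε) * Q := by
  have hsP := Real.sq_sqrt hP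
  have hsQ := Real.sq_sqrt hQ
  have hk : 2 * ε * (Real.sqrt P * Real.sqrt Q) ≤ P + ε ^ 2 * Q := by
    nlinarith [sq_nonneg (Real.sqrt P - ε * Real.sqrt Q), hsP, hsQ]
  have he : (1 + 1 / ε) * P + (1 + ε) * Q - (Real.sqrt P + Real.sqrt Q) ^ 2 =
      (P + ε ^ 2 * Q - 2 * ε * (Real.sqrt P * Real.sqrt Q)) / ε := by
    field_simp
    nlinarith [hsP, hsQ]
  have : 0 ≤ (1 + 1 / ε) * P + (1 + ε) * Q - (Real.sqrt P + Real.sqrt Q) ^ 2 := by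
    rw [he]; exact div_nonneg (by linarith) hε.le
  linarith

/-- From `√F ≤ √P + √Q` (`P, Q ≥ 0`, `ε > 0`) to `F ≤ (1 + 1/ε) P + (1 + ε) Q` (trivial if `F ≤ 0`). [folklore] -/
theorem le_of_sqrt_le_sqrt_add {F P Q ε : ℝ} (hP : 0 ≤ P) (hQ : 0 ≤ Q) (hε : 0 < ε)
    (h : Real.sqrt F ≤ Real.sqrt P + Real.sqrt Q) : F ≤ (1 + 1 / ε) * P + (1 + ε) * Q := by
  have hrhs : 0 ≤ (1 + 1 / ε) * P + (1 + ε) * Q := by positivity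
  rcases le_or_gt F 0 with hF | hF
  · linarith
  · calc F = (Real.sqrt F) ^ 2 := (Real.sq_sqrt hF.le).symm
      _ ≤ (Real.sqrt P + Real.sqrt Q) ^ 2 := pow_le_pow_left₀ (Real.sqrt_nonneg _) h 2
      _ ≤ _ := sq_sqrt_add_sqrt_le hP hQ hε

/-- **The recursion closes with fixed constants.**  With `ε = (1 − α)/2 > 0` and
`D = (1 + 1/ε)(C + 2 + B₂)/ε + E` (`B₂, E, C ≥ 0`), for every `X ≥ 1`:
`(1 + 1/ε)((C+2)X + B₂) + (1 + ε)(αDX + E) ≤ DX + E`. [folklore] -/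
theorem recursion_closes {α ε C B₂ D E X : ℝ} (hε : ε = (1 - α) / 2) (hε0 : 0 < ε)
    (hD : D = (1 + 1 / ε) * (C + 2 + B₂) / ε + E) (hB₂ : 0 ≤ B₂) (hE : 0 ≤ E) (hC : 0 ≤ C) (hX : 1 ≤ X) :
    (1 + 1 / ε) * ((C + 2) * X + B₂) + (1 + ε) * (α * D * X + E) ≤ D * X + E := by
  have hε1 : 0 ≤ 1 + 1 / ε := by positivity
  have hD0 : 0 ≤ D := by rw [hD]; positivity
  have h1 : (1 + ε) * α ≤ 1 - ε := by rw [hε]; nlinarith [sq_nonneg (1 - α)]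
  have hDX : 0 ≤ D * X := mul_nonneg hD0 (by linarith)
  have h2 : (1 + ε) * (α * D * X) ≤ (1 - ε) * (D * X) := by
    calc (1 + ε) * (α * D * X) = ((1 + ε) * α) * (D * X) := by ring
      _ ≤ (1 - ε) * (D * X) := mul_le_mul_of_nonneg_right h1 hDX
  have hεne : ε ≠ 0 := hε0.ne'
  have h3 : ε * D = (1 + 1 / ε) * (C + 2 + B₂) + ε * E := by
    rw [hD]; field_simp
  have h4 : (1 + 1 / ε) * B₂ ≤ (1 + 1 / ε) * (B₂ * X) :=
    mul_le_mul_of_nonneg_left (by nlinarith) hε1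
  have h5 : ε * E ≤ ε * (E * X) := mul_le_mul_of_nonneg_left (by nlinarith) hε0.le
  have h6 : ε * D * X = (1 + 1 / ε) * (C + 2 + B₂) * X + ε * E * X := by rw [h3]; ring
  nlinarith [h2, h4, h5, h6]

/-- **Scale arithmetic.**  For `1/2 ≤ α < 1` and `L₀ = 11^{1/(1−α)}`: `11 ≤ L₀`, and `ℓ ≥ L₀` implies
`11 ℓ^α ≤ ℓ`. [folklore] -/
theorem scale_facts {α L₀ : ℝ} (hα : 1 / 2 ≤ α) (hα1 : α < 1) (hL₀ : L₀ = (11 : ℝ) ^ (1 / (1 - α))) :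
    11 ≤ L₀ ∧ ∀ ℓ : ℝ, L₀ ≤ ℓ → 11 * ℓ ^ α ≤ ℓ := by
  have hL₀11 : 11 ≤ L₀ := by
    have h1 : (1 : ℝ) ≤ 1 / (1 - α) := by rw [le_div_iff₀ (by linarith)]; linarith
    calc (11 : ℝ) = 11 ^ (1 : ℝ) := (Real.rpow_one 11).symm
      _ ≤ 11 ^ (1 / (1 - α)) := Real.rpow_le_rpow_of_exponent_le (by norm_num) h1
      _ = L₀ := hL₀.symm
  have hL₀pow : L₀ ^ (1 - α) = 11 := by
    rw [hL₀, ← Real.rpow_mul (by norm_num), one_div_mul_cancel (by linarith : (1 - α) ≠ 0), Real.rpow_one]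
  refine ⟨hL₀11, fun ℓ hL => ?_⟩
  have hℓpos : 0 < ℓ := by linarith
  have e : ℓ ^ α * ℓ ^ (1 - α) = ℓ := by
    rw [← Real.rpow_add hℓpos, add_sub_cancel, Real.rpow_one]
  have h2 : 11 ≤ ℓ ^ (1 - α) := by
    rw [← hL₀pow]; exact Real.rpow_le_rpow (by linarith) hL (by linarith)
  calc 11 * ℓ ^ α = ℓ ^ α * 11 := mul_comm _ _
    _ ≤ ℓ ^ α * ℓ ^ (1 - α) := mul_le_mul_of_nonneg_left h2 (Real.rpow_nonneg hℓpos.le _)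
    _ = ℓ := e

/-- The floor strictly decreases along the tower: `1 ≤ ℓ' ≤ ℓ − 1` gives `⌊ℓ'⌋₊ < ⌊ℓ⌋₊`. [folklore] -/
theorem floor_lt_floor_of_le_sub_one {ℓ ℓ' : ℝ} (hℓ : 1 ≤ ℓ) (h : ℓ' ≤ ℓ - 1) : ⌊ℓ'⌋₊ < ⌊ℓ⌋₊ := by
  have h2 : 0 < ⌊ℓ⌋₊ := Nat.floor_pos.2 hℓ
  calc ⌊ℓ'⌋₊ ≤ ⌊ℓ - 1⌋₊ := Nat.floor_le_floor h
    _ = ⌊ℓ⌋₊ - 1 := Nat.floor_sub_one ℓ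
    _ < ⌊ℓ⌋₊ := by omega

/-! ### The tower: induction on the scale with fixed constants -/

/-- **The metric upgrade with closed constants.**  Under `ConvexMetricTriangle` and a normalised averaged
tube floor (`1/2 ≤ α < 1`, `0 ≤ C`, `0 < c ≤ 1`) there are `D ≥ 0` and `E` with
`Z^T_{x_c}(u,v) ≥ exp(−(D log ℓ + E))` for the trace `T` of every tube `(u, v, ℓ)`, `ℓ ≥ max(1, |u − v|)` —
strong induction on `⌊ℓ⌋₊`, the recursion `√F(ℓ) ≤ √((C+2) log ℓ + log(9/c)) + √F(ℓ^α)` being closed by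
`2√(PQ) ≤ P/ε + εQ`. [cite: BergChristensenRessel1984, Ch. 3 §3] -/
theorem tube_kernel_floor (hCMT : ConvexMetricTriangle) {α C c : ℝ} (hα : 1 / 2 ≤ α) (hα1 : α < 1)
    (hC : 0 ≤ C) (hc : 0 < c) (hc1 : c ≤ 1)
    (hA : ∀ (u v : Site 2) (ℓ : ℝ), 1 ≤ ℓ → dist (Site.toComplex u) (Site.toComplex v) ≤ ℓ → ∃ N : ℕ,
      c * ℓ ^ (-C) ≤ ∑ n ∈ Finset.range (N + 1), ∑ _ω ∈ (Zd.saws 2 n).filter (fun ω =>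
        (∀ i ≤ n, Metric.infDist (Site.toComplex (u + ω i))
          (segment ℝ (Site.toComplex u) (Site.toComplex v)) ≤ ℓ / 10 + 2) ∧
          dist (Site.toComplex (u + ω n)) (Site.toComplex v) ≤ ℓ ^ α), criticalFugacity ^ n) :
    ∃ D E : ℝ, 0 ≤ D ∧ ∀ (u v : Site 2) (ℓ : ℝ), 1 ≤ ℓ → dist (Site.toComplex u) (Site.toComplex v) ≤ ℓ →
      ∀ T : Finset (Site 2), (∀ z : Site 2, z ∈ T ↔ Site.toComplex z ∈
        Metric.cthickening (ℓ / 10 + 2) (segment ℝ (Site.toComplex u) (Site.toComplex v))) →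
        Real.exp (-(D * Real.log ℓ + E)) ≤ Zfun T criticalFugacity u v := by
  have hα0 : 0 ≤ α := by linarith
  -- ### constants (introduced as opaque reals with their defining equations)
  obtain ⟨lam, hlam⟩ : ∃ lam : ℝ, lam = -Real.log criticalFugacity := ⟨_, rfl⟩
  have hlam0 : 0 < lam := by
    rw [hlam, neg_pos]
    exact Real.log_neg criticalFugacity_pos criticalFugacity_pos_lt_one'.2
  obtain ⟨ε, hε⟩ : ∃ ε : ℝ, ε = (1 - α) / 2 := ⟨_, rfl⟩
  have hε0 : 0 < ε := by rw [hε]; linarith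
  obtain ⟨L₀, hL₀⟩ : ∃ L₀ : ℝ, L₀ = (11 : ℝ) ^ (1 / (1 - α)) := ⟨_, rfl⟩
  obtain ⟨hL₀11, h11pow⟩ := scale_facts hα hα1 hL₀
  obtain ⟨B₂, hB₂⟩ : ∃ B₂ : ℝ, B₂ = Real.log (9 / c) := ⟨_, rfl⟩
  have hB₂0 : 0 ≤ B₂ := by
    rw [hB₂]
    exact Real.log_nonneg (by rw [le_div_iff₀ hc]; linarith)
  have h9 : Real.log (c / 9) = -B₂ := by rw [hB₂, ← Real.log_inv, inv_div]
  obtain ⟨E, hE⟩ : ∃ E : ℝ, E = 2 * L₀ * lam + B₂ := ⟨_, rfl⟩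
  have hE0 : 0 ≤ E := by
    have := mul_pos (by linarith : (0 : ℝ) < 2 * L₀) hlam0
    rw [hE]; linarith
  obtain ⟨D, hD⟩ : ∃ D : ℝ, D = (1 + 1 / ε) * (C + 2 + B₂) / ε + E := ⟨_, rfl⟩
  have hD0 : 0 ≤ D := by rw [hD]; positivity
  -- ### `1 ≤ log 11`
  have hlog11 : (1 : ℝ) ≤ Real.log 11 := by
    rw [Real.le_log_iff_exp_le (by norm_num)]
    have := Real.exp_one_lt_d9
    linarith
  -- ### strong induction on `⌊ℓ⌋₊`
  suffices H : ∀ m : ℕ, ∀ ℓ : ℝ, ⌊ℓ⌋₊ = m → 1 ≤ ℓ → ∀ u v : Site 2,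
      dist (Site.toComplex u) (Site.toComplex v) ≤ ℓ → ∀ T : Finset (Site 2), (∀ z : Site 2, z ∈ T ↔
        Site.toComplex z ∈ Metric.cthickening (ℓ / 10 + 2) (segment ℝ (Site.toComplex u) (Site.toComplex v))) →
        Real.exp (-(D * Real.log ℓ + E)) ≤ Zfun T criticalFugacity u v by
    exact ⟨D, E, hD0, fun u v ℓ hℓ hd T hT => H _ ℓ rfl hℓ u v hd T hT⟩
  intro m
  induction m using Nat.strong_induction_on with
  | _ m ih =>
  intro ℓ hm hℓ u v hd T hT
  have hℓ0 : 0 ≤ ℓ := by linarith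
  have hℓpos : 0 < ℓ := by linarith
  have hX0 : 0 ≤ Real.log ℓ := Real.log_nonneg hℓ
  -- positivity and the base bound from the digital line
  obtain ⟨n, ω, hω, hn2, hωdist⟩ := exists_digital_saw u v
  have hconf : ∀ i ≤ n, u + ω i ∈ T := fun i hi =>
    (trace_infDist hℓ0 hT _).2 ((hωdist i hi).trans (by linarith))
  have hZuv : criticalFugacity ^ n ≤ Zfun T criticalFugacity u v := pow_le_zfun hω hconf
  have hZpos : 0 < Zfun T criticalFugacity u v := lt_of_lt_of_le (pow_pos criticalFugacity_pos n) hZuv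
  have hbase : Real.exp (-(2 * ℓ * lam)) ≤ Zfun T criticalFugacity u v := by
    refine le_trans ?_ hZuv
    have hxn : criticalFugacity ^ n = Real.exp (n * Real.log criticalFugacity) := by
      rw [← Real.rpow_natCast, Real.rpow_def_of_pos criticalFugacity_pos, mul_comm]
    rw [hxn, Real.exp_le_exp, hlam]
    have : (n : ℝ) ≤ 2 * ℓ := hn2.trans (by linarith)
    nlinarith
  by_cases hL : ℓ < L₀
  · -- ### base case `ℓ < L₀`
    refine le_trans ?_ hbase
    rw [Real.exp_le_exp, neg_le_neg_iff]
    have h1 : 2 * ℓ * lam ≤ 2 * L₀ * lam := by nlinarith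
    have h2 : 0 ≤ D * Real.log ℓ := mul_nonneg hD0 hX0
    rw [hE]; linarith
  · -- ### inductive case `L₀ ≤ ℓ`
    push Not at hL
    have h11ℓ : 11 ≤ ℓ := hL₀11.trans hL
    have hX1 : 1 ≤ Real.log ℓ := hlog11.trans (Real.log_le_log (by norm_num) h11ℓ)
    obtain ⟨ℓ', hℓ'⟩ : ∃ ℓ' : ℝ, ℓ' = ℓ ^ α := ⟨_, rfl⟩
    have hℓ'1 : 1 ≤ ℓ' := by rw [hℓ']; exact Real.one_le_rpow hℓ hα0
    have hℓ'0 : 0 ≤ ℓ' := by linarith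
    have h11 : 11 * ℓ' ≤ ℓ := by rw [hℓ']; exact h11pow ℓ hL
    have hfloor : ⌊ℓ'⌋₊ < m := by
      rw [← hm]; exact floor_lt_floor_of_le_sub_one hℓ (by linarith)
    -- the good endpoint
    obtain ⟨N, hN⟩ := hA u v ℓ hℓ hd
    obtain ⟨w, hwv, hZuw⟩ := exists_endpoint hα0 hα1.le hc hℓ hN hT
    clear hN
    rw [← hℓ'] at hwv
    -- the smaller tube and the induction hypothesis
    obtain ⟨T', hT'⟩ := exists_tube_trace w v hℓ'0
    have hsub : T' ⊆ T := trace_subset hℓ'0 hwv h11 hT hT'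
    have hIH := ih ⌊ℓ'⌋₊ hfloor ℓ' rfl hℓ'1 w v hwv T' hT'
    -- free energies of the two legs
    obtain ⟨P, hP⟩ : ∃ P : ℝ, P = (C + 2) * Real.log ℓ + B₂ := ⟨_, rfl⟩
    obtain ⟨Q, hQ⟩ : ∃ Q : ℝ, Q = α * D * Real.log ℓ + E := ⟨_, rfl⟩
    have hP0 : 0 ≤ P := by
      have := mul_nonneg (by linarith : (0 : ℝ) ≤ C + 2) hX0
      rw [hP]; linarith
    have hQ0 : 0 ≤ Q := by
      have := mul_nonneg (mul_nonneg hα0 hD0) hX0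
      rw [hQ]; linarith
    have hQeq : D * Real.log ℓ' + E = Q := by rw [hQ, hℓ', Real.log_rpow hℓpos]; ring
    have hZwv : Real.exp (-Q) ≤ Zfun T criticalFugacity w v := by
      rw [← hQeq]; exact hIH.trans (zfun_mono hsub w v)
    have hZuw_pos : 0 < Zfun T criticalFugacity u w :=
      lt_of_lt_of_le (mul_pos (by positivity) (Real.rpow_pos_of_pos hℓpos _)) hZuw
    have hZwv_pos : 0 < Zfun T criticalFugacity w v := lt_of_lt_of_le (Real.exp_pos _) hZwv
    have hwT : w ∈ T := right_mem_of_zfun_pos hZuw_pos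
    have hFuw : -Real.log (Zfun T criticalFugacity u w) ≤ P := by
      have h := Real.log_le_log (mul_pos (by positivity) (Real.rpow_pos_of_pos hℓpos _)) hZuw
      rw [Real.log_mul (by positivity) (Real.rpow_pos_of_pos hℓpos _).ne', Real.log_rpow hℓpos, h9] at h
      rw [hP]; linarith
    have hFwv : -Real.log (Zfun T criticalFugacity w v) ≤ Q := by
      have h := Real.log_le_log (Real.exp_pos _) hZwv
      rw [Real.log_exp] at h
      linarith
    -- the metric triangle inequality in the convex tube
    have hcmt := cmt_zfun hCMT (convex_tube u v ℓ) hT (left_mem_trace hℓ0 hT) hwT (right_mem_trace hℓ0 hT)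
      hZuw_pos hZwv_pos
    have hsum : Real.sqrt (-Real.log (Zfun T criticalFugacity u v)) ≤ Real.sqrt P + Real.sqrt Q :=
      hcmt.trans (add_le_add (Real.sqrt_le_sqrt hFuw) (Real.sqrt_le_sqrt hFwv))
    -- close the recursion
    have hF : -Real.log (Zfun T criticalFugacity u v) ≤ D * Real.log ℓ + E :=
      (le_of_sqrt_le_sqrt_add hP0 hQ0 hε0 hsum).trans (by
        rw [hP, hQ]; exact recursion_closes hε hε0 hD hB₂0 hE0 hC hX1)
    -- back to the kernel
    calc Real.exp (-(D * Real.log ℓ + E)) ≤ Real.exp (Real.log (Zfun T criticalFugacity u v)) :=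
          Real.exp_le_exp.2 (by linarith)
      _ = Zfun T criticalFugacity u v := Real.exp_log hZpos

/-! ### Normalisation of `AveragedTubeMass` -/

/-- The constants of `AveragedTubeMass` may be taken with `1/2 ≤ α < 1`, `0 ≤ C`, `0 < c ≤ 1` (weaken the
floor and widen the endpoint window, `ℓ ≥ 1`). [folklore] -/
theorem averagedTubeMass_normalise (hAvg : AveragedTubeMass) :
    ∃ α C c : ℝ, 1 / 2 ≤ α ∧ α < 1 ∧ 0 ≤ C ∧ 0 < c ∧ c ≤ 1 ∧
      ∀ (u v : Site 2) (ℓ : ℝ), 1 ≤ ℓ → dist (Site.toComplex u) (Site.toComplex v) ≤ ℓ → ∃ N : ℕ,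
        c * ℓ ^ (-C) ≤ ∑ n ∈ Finset.range (N + 1), ∑ _ω ∈ (Zd.saws 2 n).filter (fun ω =>
          (∀ i ≤ n, Metric.infDist (Site.toComplex (u + ω i))
            (segment ℝ (Site.toComplex u) (Site.toComplex v)) ≤ ℓ / 10 + 2) ∧
            dist (Site.toComplex (u + ω n)) (Site.toComplex v) ≤ ℓ ^ α), criticalFugacity ^ n := by
  obtain ⟨α, C, c, hα1, hc, h⟩ := hAvg
  refine ⟨max α (1 / 2), max C 0, min c 1, le_max_right _ _, max_lt hα1 (by norm_num), le_max_right _ _,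
    lt_min hc one_pos, min_le_right _ _, fun u v ℓ hℓ hd => ?_⟩
  obtain ⟨N, hN⟩ := h u v ℓ hℓ hd
  refine ⟨N, le_trans ?_ (hN.trans ?_)⟩
  · have hℓ0 : 0 ≤ ℓ := by linarith
    exact mul_le_mul (min_le_left _ _) (Real.rpow_le_rpow_of_exponent_le hℓ (by simp))
      (Real.rpow_nonneg hℓ0 _) hc.le
  · refine Finset.sum_le_sum fun n _ => Finset.sum_le_sum_of_subset_of_nonneg (fun ω hω => ?_)
      fun _ _ _ => pow_nonneg criticalFugacity_pos.le n
    rw [Finset.mem_filter] at hω ⊢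
    exact ⟨hω.1, hω.2.1, hω.2.2.trans (Real.rpow_le_rpow_of_exponent_le hℓ (le_max_left _ _))⟩

end ConvexMetricUpgrade

open scoped BigOperators Classical
open Literature.Probability.LatticeModels
open Literature.Probability.RandomPlanarGeometry Literature.Probability.RandomPlanarGeometry.SAW
open Summit.CriticalPhenomena.SAWScalingLimit.Theorems.IDRefutation (Zfun)
open ConvexMetricUpgrade

/-- **Item `stmt-CriticalPhenomena-13964` (`SAWEdgeOfPositiveType.ConvexMetricUpgrade`).**
`ConvexMetricTriangle → AveragedTubeMass → TubeLowerBound`: with the trace `T` of the convex tube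
`cthickening (ℓ/10 + 2) [u, v]`, the closed-constant tower `tube_kernel_floor` gives
`Z^T_{x_c}(u,v) ≥ e^{-E} ℓ^{-D}`, and `Z^T_{x_c}(u,v)` is the partial sum `N = |T|` of the tube mass of
`TubeLowerBound`. [cite: BergChristensenRessel1984, Ch. 3 §3] -/
theorem ConvexMetricUpgrade_proof :
    Summit.CriticalPhenomena.SAWScalingLimit.Theses.SAWEdgeOfPositiveType.ConvexMetricUpgrade := by
  intro hCMT hAvg
  obtain ⟨α, C, c, hα, hα1, hC, hc, hc1, hA⟩ := averagedTubeMass_normalise hAvg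
  obtain ⟨D, E, -, hDE⟩ := tube_kernel_floor hCMT hα hα1 hC hc hc1 hA
  refine ⟨D, Real.exp (-E), Real.exp_pos _, fun u v ℓ hℓ hd => ?_⟩
  have hℓ0 : 0 ≤ ℓ := by linarith
  have hℓpos : 0 < ℓ := by linarith
  obtain ⟨T, hT⟩ := exists_tube_trace u v hℓ0
  refine ⟨T.card, ?_⟩
  have hkey := hDE u v ℓ hℓ hd T hT
  have hexp : Real.exp (-E) * ℓ ^ (-D) = Real.exp (-(D * Real.log ℓ + E)) := by
    rw [Real.rpow_def_of_pos hℓpos, ← Real.exp_add]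
    congr 1; ring
  rw [hexp]
  refine hkey.trans ((zfun_le_partial T u v (Nat.le_succ _)).trans (le_of_eq ?_))
  refine Finset.sum_congr rfl fun n _ => ?_
  rw [filter_tube_eq hℓ0 hT u (v - u) n]

end Summit.CriticalPhenomena.SAWScalingLimit.Theorems

end
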